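import Literature.IUT.HodgeTheaters.DiscreteProfiniteConjugatesRankTwo
import Literature.GroupTheory.CombinatorialGroupTheory.FreeGroupSubgroupSeparable
import Mathlib.GroupTheory.QuotientGroup.Basic
import Mathlib.GroupTheory.Schreier
import Mathlib.Data.ZMod.Basic
import Mathlib.Data.Int.GCD
import HarnessLib

/-!
# [IUTchI] Lemma 2.7 (iii), free case, II: rank two in the abelianization of a finite-index subgroup

Mochizuki, *Inter-universal Teichmüller theory I*, kurims manuscript (May 2020), §2, Lemma 2.7 (iii),
p. 57: "Let `x, y ∈ G` be noncommuting elements of `G`.  Then there exists a finite index subgroup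
`G₁ ⊆ G` and a positive integer `n` such that `xⁿ, yⁿ ∈ G₁`, and the images of `xⁿ` and `yⁿ` in the
abelianization `G₁ᵃᵇ` of `G₁` generate a free abelian subgroup of rank two"
[cite: Mochizuki2012, Lem 2.7(iii) p.57].  PROOF-ONLY sequel of
`DiscreteProfiniteConjugatesRankTwo.lean` (the rank-two character `Ψ : ⟨x, y⟩ → ℤ²`); no new
definitions.

* `exists_normal_finiteIndex_disjoint_sup_of_isFreeGroup` — M. Hall's theorem in the weak form of
  the tree (`Literature.GroupTheory.CombinatorialGroupTheory.exists_normal_finiteIndex_disjoint_sup`,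
  Lyndon–Schupp I.3.10: a finitely generated subgroup of a free group disjoint from a finite set stays
  disjoint after multiplying by a suitable normal subgroup of finite index), transported from
  `FreeGroup α` to any `IsFreeGroup`;
* `rankTwoInAbelianization_of_isFreeGroup`, `rankTwoInAbelianization_freeCase` — **Lemma 2.7 (iii)
  for free groups, with `n = 1`**.  ROUTE (ours; the printed proof goes through (ii) twice and the
  inference "`x^{ma}·y^{mb} ∉ [G₁, G₁]` ⇒ `x^{na}·y^{nb} ∉ [G₁, G₁]`", p. 58, which we do not use):
  reduce `Ψ` mod `2` to `θ : J = ⟨x, y⟩ → (ℤ/2)²`; `J₂ = Ker θ` is finitely generated (index `4`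
  in the finitely generated `J`, Schreier); M. Hall gives `P ◁ G` of finite index with
  `J₂P ∩ {x, y, xy} = ∅`, whence `P ∩ J ⊆ Ker θ` (every value of `θ` is attained on
  `{1, x, y, xy}`); so `θ` extends to the finite-index subgroup `G₁ = JP = π⁻¹(π J) ∋ x, y`
  (`π : G → G/P`) as `Λ : G₁ → G₁/P ≅ J/(J ∩ P) → (ℤ/2)²`; a relation `i[x] + j[y] = 0` in `G₁ᵃᵇ`
  gives `Λ(x)ⁱ Λ(y)ʲ = 1`, i.e. `2 ∣ i` and `2 ∣ j`; since `G₁ᵃᵇ` is torsion-free (`G₁` is free)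
  we may first divide `(i, j)` by their gcd — contradiction unless `i = j = 0`;
* `rankTwoInAbelianization_of_surfaceCase` — the named statement
  `FreeOrSurface.rankTwoInAbelianization` follows from its orientable-surface-group half.

Nothing here takes a side on the disputed parts of [IUTchI–IV]: Lemma 2.7 is classical
combinatorial group theory.
-/

namespace Literature.IUT.HodgeTheaters

namespace FreeOrSurface

open Literature.GroupTheory.CombinatorialGroupTheory

universe u

/-! ### M. Hall's theorem (weak form) transported to any free group -/

/-- The tree's `exists_normal_finiteIndex_disjoint_sup` (M. Hall 1949 / Lyndon–Schupp I.3.10, weak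
form: a finitely generated subgroup `H` of a free group disjoint from a finite set `A` stays
disjoint from `A` after multiplying by some normal subgroup of finite index), transported from
`FreeGroup α` to an arbitrary `IsFreeGroup`. [cite: LyndonSchupp2001, Ch. I Prop. 3.10] -/
theorem exists_normal_finiteIndex_disjoint_sup_of_isFreeGroup {G : Type u} [Group G]
    [IsFreeGroup G] (H : Subgroup G) (hH : H.FG) (A : Set G) (hA : A.Finite)
    (hHA : Disjoint (H : Set G) A) :
    ∃ P : Subgroup G, P.Normal ∧ P.FiniteIndex ∧ Disjoint ((H ⊔ P : Subgroup G) : Set G) A := by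
  set e := IsFreeGroup.toFreeGroup G with he
  have hsurj : Function.Surjective e.toMonoidHom := fun b => ⟨e.symm b, by simp⟩
  have hH' : (H.map e.toMonoidHom).FG := fg_map_of_fg e.toMonoidHom hH
  have hHA' : Disjoint ((H.map e.toMonoidHom : Subgroup _) : Set _) (e '' A) := by
    rw [Set.disjoint_left]
    rintro _ hz ⟨a, ha, rfl⟩
    rw [SetLike.mem_coe, Subgroup.mem_map] at hz
    obtain ⟨h, hh, hha⟩ := hz
    have hha' : h = a := e.injective (by simpa using hha)
    exact Set.disjoint_left.mp hHA (hha' ▸ hh) ha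
  obtain ⟨P', hP'n, hP'f, hd⟩ :=
    exists_normal_finiteIndex_disjoint_sup (H.map e.toMonoidHom) hH' (e '' A) (hA.image e) hHA'
  haveI := hP'n
  refine ⟨P'.comap e.toMonoidHom, inferInstance, ⟨?_⟩, ?_⟩
  · rw [Subgroup.index_comap_of_surjective _ hsurj]
    exact hP'f.index_ne_zero
  · rw [Set.disjoint_left]
    intro a ha haA
    have hle : (H ⊔ P'.comap e.toMonoidHom).map e.toMonoidHom ≤ H.map e.toMonoidHom ⊔ P' := by
      rw [Subgroup.map_sup]
      exact sup_le_sup_left (Subgroup.map_comap_le _ _) _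
    exact Set.disjoint_left.mp hd (hle (Subgroup.mem_map_of_mem _ ha)) ⟨a, haA, rfl⟩

/-! ### Lemma 2.7 (iii), free case -/

/-- **Lemma 2.7 (iii), free case, with `n = 1`**: for non-commuting `x, y` in a free group `G`
there is a finite index subgroup `G₁ ∋ x, y` such that the images of `x, y` in `G₁ᵃᵇ` generate a free
abelian group of rank two (satisfy no non-trivial relation).  See the module docstring for the
route (rank-two character mod `2` + M. Hall + torsion-freeness). [cite: Mochizuki2012, Lem 2.7(iii) p.58] -/
theorem rankTwoInAbelianization_of_isFreeGroup {G : Type u} [Group G] [IsFreeGroup G] (x y : G)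
    (hxy : x * y ≠ y * x) :
    ∃ (G₁ : Subgroup G) (hx : x ∈ G₁) (hy : y ∈ G₁), G₁.FiniteIndex ∧
      ∀ i j : ℤ, Abelianization.of (⟨x, hx⟩ : G₁) ^ i * Abelianization.of (⟨y, hy⟩ : G₁) ^ j = 1 →
        i = 0 ∧ j = 0 := by
  classical
  set J := Subgroup.closure ({x, y} : Set G) with hJ
  have hxJ : x ∈ J := Subgroup.subset_closure (by simp)
  have hyJ : y ∈ J := Subgroup.subset_closure (by simp)
  obtain ⟨Ψ, hΨx, hΨy⟩ := exists_hom_closure_pair hxy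
  let ΨJ : J →* Multiplicative ℤ × Multiplicative ℤ := Ψ
  have hΨJx : ΨJ ⟨x, hxJ⟩ = (Multiplicative.ofAdd 1, 1) := hΨx
  have hΨJy : ΨJ ⟨y, hyJ⟩ = (1, Multiplicative.ofAdd 1) := hΨy
  -- reduction mod 2: `θ : J → (ℤ/2)²`, `x ↦ (1,0)`, `y ↦ (0,1)`
  let r : Multiplicative ℤ →* Multiplicative (ZMod 2) := (Int.castAddHom (ZMod 2)).toMultiplicative
  let red : Multiplicative ℤ × Multiplicative ℤ →* Multiplicative (ZMod 2) × Multiplicative (ZMod 2) :=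
    (r.comp (MonoidHom.fst _ _)).prod (r.comp (MonoidHom.snd _ _))
  let θ : J →* Multiplicative (ZMod 2) × Multiplicative (ZMod 2) := red.comp ΨJ
  have hθx : θ ⟨x, hxJ⟩ = (Multiplicative.ofAdd 1, 1) := by
    simp [θ, red, r, hΨJx]
  have hθy : θ ⟨y, hyJ⟩ = (1, Multiplicative.ofAdd 1) := by
    simp [θ, red, r, hΨJy]
  have hθxy : θ (⟨x, hxJ⟩ * ⟨y, hyJ⟩) = (Multiplicative.ofAdd 1, Multiplicative.ofAdd 1) := by
    rw [map_mul, hθx, hθy]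
    rfl
  -- `J₂ = Ker θ`, finitely generated, viewed in `G`
  let H : Subgroup G := θ.ker.map J.subtype
  haveI hJfg : Group.FG J := by
    rw [Group.fg_iff_subgroup_fg]
    exact ⟨{x, y}, by simp [hJ]⟩
  haveI : θ.ker.FiniteIndex := Subgroup.finiteIndex_ker θ
  have hHfg : H.FG := fg_map_of_fg J.subtype ((Group.fg_iff_subgroup_fg _).mp inferInstance)
  have hHA : Disjoint (H : Set G) ({x, y, x * y} : Set G) := by
    rw [Set.disjoint_left]
    rintro g hg hgA
    rw [SetLike.mem_coe, Subgroup.mem_map] at hg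
    obtain ⟨⟨g', hg'J⟩, hk, rfl⟩ := hg
    rw [MonoidHom.mem_ker] at hk
    simp only [Subgroup.coe_subtype, Set.mem_insert_iff, Set.mem_singleton_iff] at hgA
    rcases hgA with h | h | h
    · have h' : (⟨g', hg'J⟩ : J) = ⟨x, hxJ⟩ := Subtype.ext h
      rw [h', hθx] at hk
      exact absurd (congrArg Prod.fst hk) (by decide)
    · have h' : (⟨g', hg'J⟩ : J) = ⟨y, hyJ⟩ := Subtype.ext h
      rw [h', hθy] at hk
      exact absurd (congrArg Prod.snd hk) (by decide)
    · have h' : (⟨g', hg'J⟩ : J) = ⟨x, hxJ⟩ * ⟨y, hyJ⟩ := Subtype.ext h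
      rw [h', hθxy] at hk
      exact absurd (congrArg Prod.fst hk) (by decide)
  obtain ⟨P, hPn, hPf, hdisj⟩ := exists_normal_finiteIndex_disjoint_sup_of_isFreeGroup H hHfg
    {x, y, x * y} (((Set.finite_singleton _).insert _).insert _) hHA
  haveI := hPn
  haveI := hPf
  -- `P ∩ J ⊆ Ker θ`
  have hmem : ∀ (g : G) (hg : g ∈ J), g ∈ P → ∀ (a : G) (ha : a ∈ J), θ ⟨a, ha⟩ = θ ⟨g, hg⟩ →
      a ∈ ((H ⊔ P : Subgroup G) : Set G) := by
    intro g hg hgP a ha hθ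
    have h1 : a * g⁻¹ ∈ H := by
      refine Subgroup.mem_map.mpr ⟨⟨a, ha⟩ * ⟨g, hg⟩⁻¹, ?_, rfl⟩
      rw [MonoidHom.mem_ker, map_mul, map_inv, hθ, mul_inv_cancel]
    have h2 : a * g⁻¹ * g ∈ H ⊔ P := Subgroup.mul_mem_sup h1 hgP
    rwa [inv_mul_cancel_right] at h2
  have hcases : ∀ c : Multiplicative (ZMod 2) × Multiplicative (ZMod 2),
      c = 1 ∨ c = (Multiplicative.ofAdd 1, 1) ∨ c = (1, Multiplicative.ofAdd 1) ∨
        c = (Multiplicative.ofAdd 1, Multiplicative.ofAdd 1) := by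
    decide
  have hkey : ∀ (g : G) (hg : g ∈ J), g ∈ P → θ ⟨g, hg⟩ = 1 := by
    intro g hg hgP
    rcases hcases (θ ⟨g, hg⟩) with hc | hc | hc | hc
    · exact hc
    · exact absurd (hmem g hg hgP x hxJ (by rw [hθx, hc])) (Set.disjoint_left.mp hdisj.symm (by simp))
    · exact absurd (hmem g hg hgP y hyJ (by rw [hθy, hc])) (Set.disjoint_left.mp hdisj.symm (by simp))
    · have e3 : θ ⟨x * y, J.mul_mem hxJ hyJ⟩ = θ ⟨g, hg⟩ := by
        rw [hc]
        exact hθxy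
      exact absurd (hmem g hg hgP (x * y) (J.mul_mem hxJ hyJ) e3)
        (Set.disjoint_left.mp hdisj.symm (by simp))
  -- `G₁ = J · P`, realised as the preimage of the image of `J` in `G / P`
  let π : G →* G ⧸ P := QuotientGroup.mk' P
  let πJ : J →* G ⧸ P := π.comp J.subtype
  let G₁ : Subgroup G := πJ.range.comap π
  have hPG₁ : P ≤ G₁ := fun p hp => by
    rw [Subgroup.mem_comap]
    have h1 : π p = 1 := (QuotientGroup.eq_one_iff p).mpr hp
    rw [h1]
    exact one_mem _
  haveI : G₁.FiniteIndex := Subgroup.finiteIndex_of_le hPG₁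
  have hxG₁ : x ∈ G₁ := Subgroup.mem_comap.mpr ⟨⟨x, hxJ⟩, rfl⟩
  have hyG₁ : y ∈ G₁ := Subgroup.mem_comap.mpr ⟨⟨y, hyJ⟩, rfl⟩
  -- `θ` extends to `Λ : G₁ → (ℤ/2)²`
  have hker : πJ.ker ≤ θ.ker := by
    rintro ⟨g, hg⟩ hk
    rw [MonoidHom.mem_ker] at hk ⊢
    exact hkey g hg ((QuotientGroup.eq_one_iff g).mp hk)
  let θ' : J ⧸ πJ.ker →* Multiplicative (ZMod 2) × Multiplicative (ZMod 2) :=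
    QuotientGroup.lift πJ.ker θ hker
  let eKR : J ⧸ πJ.ker ≃* πJ.range := QuotientGroup.quotientKerEquivRange πJ
  let Λ : G₁ →* Multiplicative (ZMod 2) × Multiplicative (ZMod 2) :=
    θ'.comp (eKR.symm.toMonoidHom.comp (π.subgroupComap πJ.range))
  have hΛ : ∀ (g : G) (hg : g ∈ J) (hg₁ : g ∈ G₁), Λ ⟨g, hg₁⟩ = θ ⟨g, hg⟩ := by
    intro g hg hg₁
    have h1 : π.subgroupComap πJ.range ⟨g, hg₁⟩ = ⟨π g, ⟨⟨g, hg⟩, rfl⟩⟩ := rfl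
    have h2 : eKR.symm ⟨π g, ⟨⟨g, hg⟩, rfl⟩⟩ = QuotientGroup.mk ⟨g, hg⟩ := by
      rw [MulEquiv.symm_apply_eq]
      rfl
    simp only [Λ, MonoidHom.comp_apply, MulEquiv.coe_toMonoidHom, h1, h2]
    exact QuotientGroup.lift_mk' _ _ _
  -- a relation in `G₁ᵃᵇ` forces even exponents
  have step : ∀ i j : ℤ,
      Abelianization.of (⟨x, hxG₁⟩ : G₁) ^ i * Abelianization.of (⟨y, hyG₁⟩ : G₁) ^ j = 1 →
        (2 : ℤ) ∣ i ∧ (2 : ℤ) ∣ j := by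
    intro i j h
    have h' := congrArg (Abelianization.lift Λ) h
    rw [map_mul, map_zpow, map_zpow, Abelianization.lift_apply_of, Abelianization.lift_apply_of,
      hΛ x hxJ hxG₁, hΛ y hyJ hyG₁, hθx, hθy, MonoidHom.map_one] at h'
    have h1 := congrArg (fun z : Multiplicative (ZMod 2) × Multiplicative (ZMod 2) =>
      Multiplicative.toAdd z.1) h'
    have h2 := congrArg (fun z : Multiplicative (ZMod 2) × Multiplicative (ZMod 2) =>
      Multiplicative.toAdd z.2) h'
    simp [toAdd_zpow] at h1 h2
    exact ⟨(ZMod.intCast_zmod_eq_zero_iff_dvd i 2).mp h1,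
      (ZMod.intCast_zmod_eq_zero_iff_dvd j 2).mp h2⟩
  refine ⟨G₁, hxG₁, hyG₁, inferInstance, fun i j hij => ?_⟩
  by_contra hne
  have hd0 : 0 < Int.gcd i j := Int.gcd_pos_iff.mpr (by omega)
  obtain ⟨d, i', j', hd, hcop, hi, hj⟩ := Int.exists_gcd_one' hd0
  set a := Abelianization.of (⟨x, hxG₁⟩ : G₁) with ha
  set b := Abelianization.of (⟨y, hyG₁⟩ : G₁) with hb
  have hc : (a ^ i' * b ^ j') ^ d = 1 := by
    rw [mul_pow, ← zpow_natCast, ← zpow_natCast, ← zpow_mul, ← zpow_mul, ← hi, ← hj]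
    exact hij
  have h1 : a ^ i' * b ^ j' = 1 :=
    abelianization_eq_one_of_pow_eq_one (K := G₁) (Nat.pos_iff_ne_zero.mp hd) hc
  obtain ⟨hi', hj'⟩ := step i' j' h1
  have h2 : (2 : ℤ) ∣ (Int.gcd i' j' : ℤ) := by
    rw [Int.gcd_eq_gcd_ab]
    exact dvd_add (dvd_mul_of_dvd_left hi' _) (dvd_mul_of_dvd_left hj' _)
  rw [hcop] at h2
  norm_num at h2

/-- **Lemma 2.7 (iii), free case** in the shape of `FreeOrSurface.rankTwoInAbelianization` (with
`n = 1`). [cite: Mochizuki2012, Lem 2.7(iii) p.58] -/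
theorem rankTwoInAbelianization_freeCase (G : Type u) [Group G] (hG : IsFreeOfFiniteRank G)
    (x y : G) (hxy : x * y ≠ y * x) :
    ∃ (G₁ : Subgroup G) (n : ℕ) (hx : x ^ n ∈ G₁) (hy : y ^ n ∈ G₁), G₁.FiniteIndex ∧ 0 < n ∧
      ∀ i j : ℤ, Abelianization.of (⟨x ^ n, hx⟩ : G₁) ^ i *
        Abelianization.of (⟨y ^ n, hy⟩ : G₁) ^ j = 1 → i = 0 ∧ j = 0 := by
  obtain ⟨n, ⟨e⟩⟩ := hG
  haveI : IsFreeGroup G := IsFreeGroup.ofMulEquiv e.symm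
  obtain ⟨G₁, hx, hy, hfi, h⟩ := rankTwoInAbelianization_of_isFreeGroup x y hxy
  have hx1 : x ^ 1 ∈ G₁ := by rw [pow_one]; exact hx
  have hy1 : y ^ 1 ∈ G₁ := by rw [pow_one]; exact hy
  refine ⟨G₁, 1, hx1, hy1, hfi, one_pos, fun i j hij => h i j ?_⟩
  have ex : (⟨x ^ 1, hx1⟩ : G₁) = ⟨x, hx⟩ := Subtype.ext (pow_one x)
  have ey : (⟨y ^ 1, hy1⟩ : G₁) = ⟨y, hy⟩ := Subtype.ext (pow_one y)
  rw [ex, ey] at hij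
  exact hij

/-- Reduction for **Lemma 2.7 (iii)**: the named statement follows from its orientable-surface-group
half (the free half being `rankTwoInAbelianization_freeCase`). [cite: Mochizuki2012, Lem 2.7(iii) p.58] -/
theorem rankTwoInAbelianization_of_surfaceCase
    (hS : ∀ (G : Type u) [Group G], IsOrientableSurfaceGroup G → ∀ x y : G, x * y ≠ y * x →
      ∃ (G₁ : Subgroup G) (n : ℕ) (hx : x ^ n ∈ G₁) (hy : y ^ n ∈ G₁), G₁.FiniteIndex ∧ 0 < n ∧
        ∀ i j : ℤ, Abelianization.of (⟨x ^ n, hx⟩ : G₁) ^ i *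
          Abelianization.of (⟨y ^ n, hy⟩ : G₁) ^ j = 1 → i = 0 ∧ j = 0) :
    rankTwoInAbelianization.{u} := by
  intro G _ hG x y hxy
  rcases hG with hF | hSfc
  · exact rankTwoInAbelianization_freeCase G hF x y hxy
  · exact hS G hSfc x y hxy

end FreeOrSurface

end Literature.IUT.HodgeTheaters
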